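import Literature.NumberTheory.Sieve.BombieriAsymptoticSieveLeibniz
import Literature.NumberTheory.Sieve.BombieriAsymptoticSieveSmoothPart
import Literature.NumberTheory.Sieve.BombieriAsymptoticSieve
import Mathlib.Data.Nat.Factorization.Basic
import Mathlib.Data.Nat.Squarefree
import HarnessLib

/-!
# Bombieri's asymptotic sieve: combinatorics of the `Σ₀`-estimate

Topic `Literature/NumberTheory/Sieve`, companion ("Proofs") file of `BombieriAsymptoticSieve.lean`
([BombieriRIMS1977]; [FriedlanderIwaniecPisa1978] Lemma 10 and §6, proof of Lemma 24). All PROVED: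

* `sigma0_le_sum_smoothPart` — `Σ₀` regrouped by the `B`-smooth part `q = smoothPart B n`
  (`n = n₁ n₂`, p. 748): `Σ₀ ≤ ∑_c (k choose c)(log x)^{k−c} ∑_{q} Λ_c(q) M(q)`,
  `M(q) = ∑_{n ≤ x, smoothPart B n = q} a_n`, over `q ≠ 1` `B`-smooth with a prime factor `< z`;
* `exists_primePow_window`, `sum_bad_smoothPart_le` — the large smooth parts (`q > √x`, `ω(q) ≤ k`)
  force a prime-power divisor `p^b`, `b ≥ 2`, in the window `[x^{2θ}, x^{3θ})`, `θ = 1/(8k)`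
  (the `S₁`-part, p. 748), whence a union bound by `∑ A(x; p^b)`;
* `card_primeFactors_le_log`, `card_powerset_filter_card_le`, `card_fiber_le`, `sum_triples_le` —
  counting the representations `m = q e d` (`e` squarefree dividing `q`, `(d, q) = 1`,
  `ω(q) ≤ k`): at most `((ω(m)+1)^k)²`, so the remainders `R(x; qed)` of the subsequences are
  controlled by (A₂) with a loss `(log x)^{O(k)}`.
-/

noncomputable section

namespace Literature.NumberTheory.Sieve

namespace BombieriSieve

open Finset ArithmeticFunction
open scoped ArithmeticFunction.Moebius ArithmeticFunction.vonMangoldt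

/-! ### `Σ₀` regrouped by the smooth part -/

/-- `Λ_j(r) ≤ (log x)^j` for `1 ≤ r ≤ x` and every `j` (`j = 0`: `Λ_0(r) = [r = 1] ≤ 1`). [folklore] -/
theorem generalizedVonMangoldt_le_pow_log {j r : ℕ} {x : ℝ} (hr : 1 ≤ r) (hrx : (r : ℝ) ≤ x) :
    generalizedVonMangoldt j r ≤ Real.log x ^ j := by
  have hlogr : 0 ≤ Real.log r := Real.log_natCast_nonneg r
  have hlog : Real.log r ≤ Real.log x := Real.log_le_log (by exact_mod_cast hr) hrx
  rcases Nat.eq_zero_or_pos j with rfl | hj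
  · rw [pow_zero, generalizedVonMangoldt_zero]
    by_cases h1 : r = 1
    · rw [h1, ArithmeticFunction.one_one]
    · rw [ArithmeticFunction.one_apply_ne h1]
      exact zero_le_one
  · exact (generalizedVonMangoldt_le hj r).trans (pow_le_pow_left₀ hlogr hlog j)

/-- **The Leibniz bound for `n = q r`** (`q = smoothPart B n`, `r = n/q` coprime to `q`, `n ≤ x`,
`q ≠ 1`): `Λ_k(n) ≤ ∑_{c=0}^{k} (k choose c) (log x)^{k−c} Λ_c(q)` (the term `c = 0` vanishes as
`Λ_0(q) = 0`; `Λ_{k−c}(r) ≤ (log x)^{k−c}`). [folklore] -/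
theorem generalizedVonMangoldt_le_sum_smoothPart {k n B : ℕ} {x : ℝ} (hn : n ≠ 0)
    (hnx : (n : ℝ) ≤ x) (hq1 : smoothPart B n ≠ 1) :
    generalizedVonMangoldt k n ≤
      ∑ c ∈ Finset.range (k + 1), (k.choose c : ℝ) * Real.log x ^ (k - c) *
        generalizedVonMangoldt c (smoothPart B n) := by
  set q := smoothPart B n with hq
  set r := n / q with hr
  have hdec : q * r = n := smoothPart_mul_div hn B
  have hcop : q.Coprime r := coprime_smoothPart_div hn
  have hr1 : 1 ≤ r := by
    rcases Nat.eq_zero_or_pos r with h0 | h0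
    · rw [h0, mul_zero] at hdec; exact absurd hdec.symm hn
    · exact h0
  have hrx : (r : ℝ) ≤ x := by
    refine le_trans ?_ hnx
    exact_mod_cast Nat.div_le_self n q
  rw [← hdec, generalizedVonMangoldt_mul_of_coprime' hcop]
  refine Finset.sum_le_sum fun c _ => ?_
  rcases Nat.eq_zero_or_pos c with rfl | hc
  · rw [generalizedVonMangoldt_zero_apply_of_ne_one hq1, zero_mul, mul_zero, mul_zero]
  · calc (k.choose c : ℝ) * (generalizedVonMangoldt c q * generalizedVonMangoldt (k - c) r)
        ≤ (k.choose c : ℝ) * (generalizedVonMangoldt c q * Real.log x ^ (k - c)) :=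
          mul_le_mul_of_nonneg_left (mul_le_mul_of_nonneg_left
            (generalizedVonMangoldt_le_pow_log hr1 hrx) (generalizedVonMangoldt_nonneg _ _))
            (Nat.cast_nonneg _)
      _ = (k.choose c : ℝ) * Real.log x ^ (k - c) * generalizedVonMangoldt c q := by ring

/-- For `n ≤ N` not coprime to `P(z)` and `⌈z⌉₊ ≤ B`, the smooth part `q = smoothPart B n` lies in
`Qset = {q ≤ N : B-smooth, q ≠ 1, minFac q < ⌈z⌉₊}`. [folklore] -/
theorem smoothPart_mem_of_not_coprime {n N B : ℕ} {z : ℝ} (hn : n ∈ Ioc 0 N) (hzB : ⌈z⌉₊ ≤ B)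
    (hnz : ¬ n.Coprime (primesProdBelow z)) :
    smoothPart B n ∈ (Nat.smoothNumbersUpTo N B).filter
      (fun q : ℕ => q ≠ 1 ∧ Nat.minFac q < ⌈z⌉₊) := by
  obtain ⟨hn0, hnN⟩ := Finset.mem_Ioc.mp hn
  have hn0' : n ≠ 0 := hn0.ne'
  rw [coprime_primesProdBelow_iff] at hnz
  simp only [not_forall, not_not] at hnz
  obtain ⟨p, hp, hpn⟩ := hnz
  obtain ⟨hpz, hpp⟩ := Nat.mem_primesBelow.mp hp
  have hpq : p ∣ smoothPart B n := (prime_dvd_smoothPart_iff hpp (hpz.trans_le hzB) hn0').mpr hpn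
  refine Finset.mem_filter.mpr ⟨Nat.mem_smoothNumbersUpTo.mpr ⟨?_, smoothPart_mem_smoothNumbers B n⟩,
    ?_, ?_⟩
  · exact (Nat.le_of_dvd hn0 (smoothPart_dvd hn0' B)).trans hnN
  · intro h1
    rw [h1] at hpq
    exact hpp.one_lt.ne' (Nat.dvd_one.mp hpq)
  · exact (Nat.minFac_le_of_dvd hpp.two_le hpq).trans_lt hpz

/-- **`Σ₀` regrouped by the `B`-smooth part** ([FriedlanderIwaniecPisa1978] §6, p. 748: `n = n₁n₂`;
here for `⌈z⌉₊ ≤ B`, i.e. the primes `< z` are among those `< B`), for `x ≥ 1`: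
`Σ₀ ≤ ∑_{c=0}^{k} (k choose c) (log x)^{k−c} ∑_{q ∈ Qset} Λ_c(q) M(q)` with
`M(q) = ∑_{n ≤ x, smoothPart B n = q} a_n` and `Qset = {q ≤ x : B-smooth, q ≠ 1, minFac q < z}`.
[cite: FriedlanderIwaniecPisa1978, Lemma 24 (proof, S₂)] -/
theorem sigma0_le_sum_smoothPart (A : SieveSequence) (k : ℕ) {x z : ℝ} {B : ℕ} (hx : 1 ≤ x)
    (hzB : ⌈z⌉₊ ≤ B) :
    sigma0 A k x z ≤
      ∑ c ∈ Finset.range (k + 1), (k.choose c : ℝ) * Real.log x ^ (k - c) *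
        ∑ q ∈ (Nat.smoothNumbersUpTo ⌊x⌋₊ B).filter (fun q : ℕ => q ≠ 1 ∧ Nat.minFac q < ⌈z⌉₊),
          generalizedVonMangoldt c q *
            ∑ n ∈ (Ioc 0 ⌊x⌋₊).filter (fun n : ℕ => smoothPart B n = q), A.a n := by
  set N := ⌊x⌋₊ with hN
  set S := (Ioc 0 N).filter (fun n : ℕ => ¬ n.Coprime (primesProdBelow z)) with hS
  set Qset := (Nat.smoothNumbersUpTo N B).filter (fun q : ℕ => q ≠ 1 ∧ Nat.minFac q < ⌈z⌉₊)
    with hQ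
  have hL : 0 ≤ Real.log x := Real.log_nonneg hx
  -- Step 1: termwise Leibniz bound
  have h1 : sigma0 A k x z ≤ ∑ n ∈ S, ∑ c ∈ Finset.range (k + 1),
      (k.choose c : ℝ) * Real.log x ^ (k - c) * (generalizedVonMangoldt c (smoothPart B n) * A.a n) := by
    rw [sigma0, ← hN, ← hS]
    refine Finset.sum_le_sum fun n hn => ?_
    obtain ⟨hn', hnz⟩ := Finset.mem_filter.mp hn
    have hmem := smoothPart_mem_of_not_coprime hn' hzB hnz
    obtain ⟨-, hq1, -⟩ := Finset.mem_filter.mp hmem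
    obtain ⟨hn0, hnN⟩ := Finset.mem_Ioc.mp hn'
    have hnx : (n : ℝ) ≤ x := (Nat.cast_le.mpr hnN).trans (Nat.floor_le (zero_le_one.trans hx))
    calc generalizedVonMangoldt k n * A.a n
        ≤ (∑ c ∈ Finset.range (k + 1), (k.choose c : ℝ) * Real.log x ^ (k - c) *
            generalizedVonMangoldt c (smoothPart B n)) * A.a n :=
          mul_le_mul_of_nonneg_right (generalizedVonMangoldt_le_sum_smoothPart hn0.ne' hnx hq1)
            (A.a_nonneg n)
      _ = _ := by
          rw [Finset.sum_mul]
          exact Finset.sum_congr rfl fun c _ => by ring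
  refine h1.trans ?_
  -- Step 2: interchange and regroup by `q = smoothPart B n`
  rw [Finset.sum_comm]
  refine Finset.sum_le_sum fun c _ => ?_
  rw [← Finset.mul_sum]
  refine mul_le_mul_of_nonneg_left ?_ (mul_nonneg (Nat.cast_nonneg _) (pow_nonneg hL _))
  have hmaps : ∀ n ∈ S, smoothPart B n ∈ Qset := fun n hn =>
    smoothPart_mem_of_not_coprime (Finset.mem_filter.mp hn).1 hzB (Finset.mem_filter.mp hn).2
  rw [← Finset.sum_fiberwise_of_maps_to hmaps]
  refine Finset.sum_le_sum fun q _ => ?_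
  rw [Finset.mul_sum]
  have hsub : S.filter (fun n : ℕ => smoothPart B n = q) ⊆
      (Ioc 0 N).filter (fun n : ℕ => smoothPart B n = q) :=
    Finset.filter_subset_filter _ (Finset.filter_subset _ _)
  calc ∑ n ∈ S.filter (fun n : ℕ => smoothPart B n = q), generalizedVonMangoldt c (smoothPart B n) * A.a n
      = ∑ n ∈ S.filter (fun n : ℕ => smoothPart B n = q), generalizedVonMangoldt c q * A.a n :=
        Finset.sum_congr rfl fun n hn => by rw [(Finset.mem_filter.mp hn).2]
    _ ≤ ∑ n ∈ (Ioc 0 N).filter (fun n : ℕ => smoothPart B n = q), generalizedVonMangoldt c q * A.a n :=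
        Finset.sum_le_sum_of_subset_of_nonneg hsub fun n _ _ =>
          mul_nonneg (generalizedVonMangoldt_nonneg _ _) (A.a_nonneg n)

end BombieriSieve

end Literature.NumberTheory.Sieve

namespace Literature.NumberTheory.Sieve

namespace BombieriSieve

open Finset ArithmeticFunction
open scoped ArithmeticFunction.Moebius ArithmeticFunction.vonMangoldt

/-! ### The bad smooth parts: a prime-power divisor in a window -/

/-- **Window lemma** ([FriedlanderIwaniecPisa1978] §6, proof of Lemma 24, the `S₁`-part: "let
`m₁^g` be the largest `g`-th power dividing `n₁` … `m₁^g > X^{θ/4}`", in the form used here).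
Let `θ = 1/(8k)`, `x > 1`. If `q` is `x^θ`-smooth with at most `k` distinct prime factors,
`q ∣ n` and `q > x^{1/2}`, then `n` is divisible by a prime power `p^b`, `p < x^θ`, `b ≥ 2`,
in the window `x^{2θ} ≤ p^b < x^{3θ}`: indeed `rad q < x^{kθ}`, so `∏_{p ∣ q} p^{v_p(q)−1} =
q/rad q > x^{1/2−kθ} = (x^{3θ})^k` and some `p^{v_p(q)−1} > x^{3θ}`; take `b` least with
`p^b ≥ x^{2θ}`. [cite: FriedlanderIwaniecPisa1978, Lemma 24 (proof, S₁)] -/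
theorem exists_primePow_window {k : ℕ} (hk : 1 ≤ k) {x : ℝ} (hx : 1 < x) {q n : ℕ}
    (hqB : q ∈ Nat.smoothNumbers ⌈x ^ ((8 * k : ℝ)⁻¹)⌉₊) (hω : q.primeFactors.card ≤ k)
    (hqn : q ∣ n) (hqx : Real.sqrt x < q) :
    ∃ p b : ℕ, p.Prime ∧ p < ⌈x ^ ((8 * k : ℝ)⁻¹)⌉₊ ∧ 2 ≤ b ∧ p ^ b ∣ n ∧
      x ^ (2 * (8 * k : ℝ)⁻¹) ≤ (p : ℝ) ^ b ∧ (p : ℝ) ^ b < x ^ (3 * (8 * k : ℝ)⁻¹) := by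
  classical
  set θ : ℝ := (8 * k : ℝ)⁻¹ with hθ
  have hx0 : 0 < x := by linarith
  have hk0 : (0 : ℝ) < k := by exact_mod_cast hk
  have hθ0 : 0 < θ := by rw [hθ]; positivity
  have hθk : θ * k = 1 / 8 := by rw [hθ]; field_simp
  have hq0 : q ≠ 0 := Nat.ne_zero_of_mem_smoothNumbers hqB
  set F := q.primeFactors with hF
  set v := q.factorization with hv
  -- primes of `q` are `< x^θ`
  have hpF : ∀ p ∈ F, p.Prime ∧ (p : ℝ) < x ^ θ ∧ 1 ≤ v p := by
    intro p hp
    have hpp := Nat.prime_of_mem_primeFactors hp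
    have hpq := Nat.dvd_of_mem_primeFactors hp
    refine ⟨hpp, Nat.lt_ceil.mp ((Nat.mem_smoothNumbers'.mp hqB) p hpp hpq), ?_⟩
    exact hpp.factorization_pos_of_dvd hq0 hpq
  -- `q = ∏ p^{v_p} = (∏ p) (∏ p^{v_p - 1})`
  have hqprod : (q : ℝ) = (∏ p ∈ F, (p : ℝ)) * ∏ p ∈ F, (p : ℝ) ^ (v p - 1) := by
    have h := Nat.prod_factorization_pow_eq_self hq0
    rw [Finsupp.prod, Nat.support_factorization] at h
    conv_lhs => rw [← h]
    push_cast
    rw [← Finset.prod_mul_distrib]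
    refine Finset.prod_congr rfl fun p hp => ?_
    rw [← pow_succ', Nat.sub_add_cancel (hpF p hp).2.2]
  -- `∏ p ≤ (x^θ)^k`
  have hxθ1 : 1 ≤ x ^ θ := Real.one_le_rpow hx.le hθ0.le
  have hrad : ∏ p ∈ F, (p : ℝ) ≤ (x ^ θ) ^ k := by
    calc ∏ p ∈ F, (p : ℝ) ≤ ∏ _p ∈ F, x ^ θ :=
          Finset.prod_le_prod (fun p _ => Nat.cast_nonneg p) fun p hp => (hpF p hp).2.1.le
      _ = (x ^ θ) ^ F.card := Finset.prod_const _
      _ ≤ (x ^ θ) ^ k := pow_le_pow_right₀ hxθ1 hω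
  have hradpos : 0 < ∏ p ∈ F, (p : ℝ) :=
    Finset.prod_pos fun p hp => by exact_mod_cast (hpF p hp).1.pos
  -- `(x^θ)^k = x^{1/8}`, `√x / x^{1/8} = x^{3/8} = (x^{3θ})^k`
  have hpow1 : (x ^ θ) ^ k = x ^ (1 / 8 : ℝ) := by
    rw [← Real.rpow_natCast, ← Real.rpow_mul hx0.le, hθk]
  have hpow3 : (x ^ (3 * θ)) ^ k = x ^ (3 / 8 : ℝ) := by
    rw [← Real.rpow_natCast, ← Real.rpow_mul hx0.le]
    congr 1
    calc 3 * θ * k = 3 * (θ * k) := by ring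
      _ = 3 / 8 := by rw [hθk]; norm_num
  have hsqrt : Real.sqrt x = x ^ (1 / 8 : ℝ) * x ^ (3 / 8 : ℝ) := by
    rw [Real.sqrt_eq_rpow, ← Real.rpow_add hx0]; norm_num
  -- hence `∏ p^{v_p - 1} > (x^{3θ})^k`
  have hbig : (x ^ (3 * θ)) ^ k < ∏ p ∈ F, (p : ℝ) ^ (v p - 1) := by
    rw [hpow3]
    have h1 : x ^ (1 / 8 : ℝ) * x ^ (3 / 8 : ℝ) < (∏ p ∈ F, (p : ℝ)) * ∏ p ∈ F, (p : ℝ) ^ (v p - 1) := by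
      rw [← hsqrt, ← hqprod]; exact hqx
    have h2 : 0 < x ^ (3 / 8 : ℝ) := Real.rpow_pos_of_pos hx0 _
    by_contra hle
    rw [not_lt] at hle
    have : (∏ p ∈ F, (p : ℝ)) * ∏ p ∈ F, (p : ℝ) ^ (v p - 1) ≤ x ^ (1 / 8 : ℝ) * x ^ (3 / 8 : ℝ) := by
      rw [← hpow1]
      exact mul_le_mul hrad hle (Finset.prod_nonneg fun p _ => pow_nonneg (Nat.cast_nonneg p) _)
        (pow_nonneg (Real.rpow_nonneg hx0.le _) _)
    linarith
  -- pigeonhole: some `p ∈ F` has `p^{v_p - 1} > x^{3θ}`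
  have hx3θ : 0 ≤ x ^ (3 * θ) := Real.rpow_nonneg hx0.le _
  obtain ⟨p, hpF', hplarge⟩ : ∃ p ∈ F, x ^ (3 * θ) < (p : ℝ) ^ (v p - 1) := by
    by_contra hnone
    simp only [not_exists, not_and, not_lt] at hnone
    have : ∏ p ∈ F, (p : ℝ) ^ (v p - 1) ≤ (x ^ (3 * θ)) ^ k :=
      calc ∏ p ∈ F, (p : ℝ) ^ (v p - 1) ≤ ∏ _p ∈ F, x ^ (3 * θ) :=
            Finset.prod_le_prod (fun p _ => pow_nonneg (Nat.cast_nonneg p) _) hnone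
        _ = (x ^ (3 * θ)) ^ F.card := Finset.prod_const _
        _ ≤ (x ^ (3 * θ)) ^ k := pow_le_pow_right₀ (Real.one_le_rpow hx.le (by positivity)) hω
    linarith
  obtain ⟨hpp, hpθ, hv1⟩ := hpF p hpF'
  have hp0 : (0 : ℝ) < p := by exact_mod_cast hpp.pos
  -- `x^{2θ} ≤ x^{3θ} < p^{v_p - 1}`: the set of admissible exponents is nonempty
  have h23 : x ^ (2 * θ) ≤ x ^ (3 * θ) := Real.rpow_le_rpow_of_exponent_le hx.le (by linarith)
  have hex : ∃ b : ℕ, x ^ (2 * θ) ≤ (p : ℝ) ^ b := ⟨v p - 1, h23.trans hplarge.le⟩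
  set b := Nat.find hex with hb
  have hbge : x ^ (2 * θ) ≤ (p : ℝ) ^ b := Nat.find_spec hex
  have hble : b ≤ v p - 1 := Nat.find_min' hex (h23.trans hplarge.le)
  -- `b ≥ 2`: `p^0 = 1 < x^{2θ}` and `p^1 = p < x^θ ≤ x^{2θ}`
  have hx2θ1 : 1 < x ^ (2 * θ) := Real.one_lt_rpow hx (by positivity)
  have hθ2θ : x ^ θ ≤ x ^ (2 * θ) := Real.rpow_le_rpow_of_exponent_le hx.le (by linarith)
  have hb2 : 2 ≤ b := by
    by_contra hlt
    have hb1 : b ≤ 1 := by omega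
    have : (p : ℝ) ^ b ≤ p := by
      calc (p : ℝ) ^ b ≤ (p : ℝ) ^ 1 := pow_le_pow_right₀ (by exact_mod_cast hpp.one_lt.le) hb1
        _ = p := pow_one _
    linarith
  -- the upper end of the window, by minimality of `b`
  have hbmin : (p : ℝ) ^ (b - 1) < x ^ (2 * θ) := by
    have := Nat.find_min hex (show b - 1 < Nat.find hex by rw [← hb]; omega)
    exact lt_of_not_ge this
  refine ⟨p, b, hpp, Nat.lt_ceil.mpr hpθ, hb2, ?_, hbge, ?_⟩
  · -- `p^b ∣ p^{v_p(q)} ∣ q ∣ n`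
    exact ((pow_dvd_pow p (hble.trans (Nat.sub_le _ _))).trans (Nat.ordProj_dvd q p)).trans hqn
  · calc (p : ℝ) ^ b = (p : ℝ) ^ (b - 1) * p := by rw [← pow_succ, Nat.sub_add_cancel (by omega)]
      _ < x ^ (2 * θ) * x ^ θ := mul_lt_mul'' hbmin hpθ (pow_nonneg hp0.le _) hp0.le
      _ = x ^ (3 * θ) := by rw [← Real.rpow_add hx0]; ring_nf

/-- **Mass of the integers with a bad smooth part.** With `N = ⌊x⌋`, `B = ⌈x^θ⌉`, `θ = 1/(8k)`,
the `a`-mass of the `n ≤ x` whose `B`-smooth part `q` has `ω(q) ≤ k` and `q > √x` is at most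
`∑_{(p,b) ∈ W} A(x; p^b)` over the window `W = {(p, b) : p < x^θ, 2 ≤ b ≤ log₂ N, x^{2θ} ≤ p^b < x^{3θ}}`
(each such `n` is divisible by some `p^b`, `(p,b) ∈ W`; union bound). [folklore] -/
theorem sum_bad_smoothPart_le (A : SieveSequence) {k : ℕ} (hk : 1 ≤ k) {x : ℝ} (hx : 1 < x) :
    ∑ n ∈ (Ioc 0 ⌊x⌋₊).filter (fun n : ℕ =>
        (smoothPart ⌈x ^ ((8 * k : ℝ)⁻¹)⌉₊ n).primeFactors.card ≤ k ∧
          Real.sqrt x < smoothPart ⌈x ^ ((8 * k : ℝ)⁻¹)⌉₊ n), A.a n ≤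
      ∑ w ∈ ((Nat.primesBelow ⌈x ^ ((8 * k : ℝ)⁻¹)⌉₊) ×ˢ Finset.Icc 2 (Nat.log 2 ⌊x⌋₊)).filter
          (fun w : ℕ × ℕ => x ^ (2 * (8 * k : ℝ)⁻¹) ≤ (w.1 : ℝ) ^ w.2 ∧
            (w.1 : ℝ) ^ w.2 < x ^ (3 * (8 * k : ℝ)⁻¹)),
        A.congrSum (w.1 ^ w.2) x := by
  set B := ⌈x ^ ((8 * k : ℝ)⁻¹)⌉₊ with hB
  set N := ⌊x⌋₊ with hN
  set U := (Ioc 0 N).filter (fun n : ℕ => (smoothPart B n).primeFactors.card ≤ k ∧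
      Real.sqrt x < smoothPart B n) with hU
  set W := ((Nat.primesBelow B) ×ˢ Finset.Icc 2 (Nat.log 2 N)).filter
      (fun w : ℕ × ℕ => x ^ (2 * (8 * k : ℝ)⁻¹) ≤ (w.1 : ℝ) ^ w.2 ∧
        (w.1 : ℝ) ^ w.2 < x ^ (3 * (8 * k : ℝ)⁻¹)) with hW
  -- each `n ∈ U` is divisible by some `p^b`, `(p, b) ∈ W`
  have hcover : ∀ n ∈ U, ∃ w ∈ W, w.1 ^ w.2 ∣ n := by
    intro n hn
    obtain ⟨hn', hω, hbig⟩ := Finset.mem_filter.mp hn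
    obtain ⟨hn0, hnN⟩ := Finset.mem_Ioc.mp hn'
    obtain ⟨p, b, hpp, hpB, hb2, hpbn, hlo, hhi⟩ := exists_primePow_window hk hx
      (smoothPart_mem_smoothNumbers B n) hω (smoothPart_dvd hn0.ne' B) hbig
    refine ⟨(p, b), Finset.mem_filter.mpr ⟨Finset.mem_product.mpr ⟨Nat.mem_primesBelow.mpr
      ⟨hpB, hpp⟩, Finset.mem_Icc.mpr ⟨hb2, ?_⟩⟩, hlo, hhi⟩, hpbn⟩
    -- `b ≤ log₂ N` since `p^b ∣ n ≤ N`
    have h1 : p ^ b ≤ n := Nat.le_of_dvd hn0 hpbn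
    calc b ≤ Nat.log p n := Nat.le_log_of_pow_le hpp.one_lt h1
      _ ≤ Nat.log 2 n := Nat.log_anti_left (by norm_num) hpp.two_le
      _ ≤ Nat.log 2 N := Nat.log_mono_right hnN
  -- union bound
  classical
  calc ∑ n ∈ U, A.a n ≤ ∑ n ∈ U, ∑ w ∈ W, if w.1 ^ w.2 ∣ n then A.a n else 0 := by
        refine Finset.sum_le_sum fun n hn => ?_
        obtain ⟨w, hw, hwn⟩ := hcover n hn
        calc A.a n = if w.1 ^ w.2 ∣ n then A.a n else 0 := by rw [if_pos hwn]
          _ ≤ ∑ w' ∈ W, if w'.1 ^ w'.2 ∣ n then A.a n else 0 :=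
              Finset.single_le_sum (f := fun w' : ℕ × ℕ => if w'.1 ^ w'.2 ∣ n then A.a n else 0)
                (fun w' _ => by split_ifs; exacts [A.a_nonneg n, le_rfl]) hw
    _ ≤ ∑ n ∈ Ioc 0 N, ∑ w ∈ W, if w.1 ^ w.2 ∣ n then A.a n else 0 :=
        Finset.sum_le_sum_of_subset_of_nonneg (Finset.filter_subset _ _) fun n _ _ =>
          Finset.sum_nonneg fun w _ => by split_ifs; exacts [A.a_nonneg n, le_rfl]
    _ = ∑ w ∈ W, A.congrSum (w.1 ^ w.2) x := by
        rw [Finset.sum_comm]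
        refine Finset.sum_congr rfl fun w _ => ?_
        rw [SieveSequence.congrSum, ← hN, Finset.sum_filter]

end BombieriSieve

end Literature.NumberTheory.Sieve

namespace Literature.NumberTheory.Sieve

namespace BombieriSieve

open Finset ArithmeticFunction Filter
open scoped ArithmeticFunction.Moebius ArithmeticFunction.vonMangoldt Topology

/-! ### Counting the representations `m = q e d` -/

/-- `ω(m) ≤ log₂ m`: the distinct primes of `m ≠ 0` have product `≥ 2^{ω(m)}` dividing `m`. [folklore] -/
theorem card_primeFactors_le_log (m : ℕ) : m.primeFactors.card ≤ Nat.log 2 m := by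
  rcases Nat.eq_zero_or_pos m with rfl | hm
  · simp
  refine Nat.le_log_of_pow_le one_lt_two ?_
  calc 2 ^ m.primeFactors.card = ∏ _p ∈ m.primeFactors, 2 := (Finset.prod_const 2).symm
    _ ≤ ∏ p ∈ m.primeFactors, p :=
        Finset.prod_le_prod' fun p hp => (Nat.prime_of_mem_primeFactors hp).two_le
    _ ≤ m := Nat.le_of_dvd hm (Nat.prod_primeFactors_dvd m)

/-- `#{S ⊆ F : |S| ≤ k} ≤ (|F| + 1)^k` (`∑_{i ≤ k} (n choose i) ≤ ∑_{i ≤ k} (k choose i) n^i =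
(n+1)^k`). [folklore] -/
theorem card_powerset_filter_card_le (F : Finset ℕ) (k : ℕ) :
    (F.powerset.filter (fun S : Finset ℕ => S.card ≤ k)).card ≤ (F.card + 1) ^ k := by
  have h1 : F.powerset.filter (fun S : Finset ℕ => S.card ≤ k) =
      (Finset.range (k + 1)).biUnion (fun i => F.powersetCard i) := by
    ext S
    simp only [Finset.mem_filter, Finset.mem_powerset, Finset.mem_biUnion, Finset.mem_range,
      Finset.mem_powersetCard]
    constructor
    · rintro ⟨hS, hc⟩; exact ⟨S.card, Nat.lt_succ_of_le hc, hS, rfl⟩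
    · rintro ⟨i, hi, hS, rfl⟩; exact ⟨hS, Nat.lt_succ_iff.mp hi⟩
  rw [h1]
  refine (Finset.card_biUnion_le).trans ?_
  calc ∑ i ∈ Finset.range (k + 1), (F.powersetCard i).card
      = ∑ i ∈ Finset.range (k + 1), F.card.choose i := by simp [Finset.card_powersetCard]
    _ ≤ ∑ i ∈ Finset.range (k + 1), F.card ^ i * 1 ^ (k - i) * k.choose i := by
        refine Finset.sum_le_sum fun i hi => ?_
        rw [one_pow, mul_one]
        calc F.card.choose i ≤ F.card ^ i := Nat.choose_le_pow _ _
          _ = F.card ^ i * 1 := (mul_one _).symm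
          _ ≤ F.card ^ i * k.choose i := Nat.mul_le_mul_left _
              (Nat.choose_pos (Nat.lt_succ_iff.mp (Finset.mem_range.mp hi)))
    _ = (F.card + 1) ^ k := (add_pow F.card 1 k).symm

/-- **The fiber bound.** For `m ≠ 0`, among triples `(q, d, e)` with `q e d = m`, `e` squarefree,
`e ∣ q`, `(d, q) = 1` and `ω(q) ≤ k`, the map `(q, d, e) ↦ (primes of q, primes of e)` is
injective (`e = ∏` its primes; `v_p(qe) = v_p(m)` at the primes of `q` and `0` elsewhere;
`d = m/(qe)`), so there are at most `((ω(m) + 1)^k)²` of them in any finite set of such triples.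
[folklore] -/
theorem card_fiber_le {T : Finset ((_ : ℕ) × (ℕ × ℕ))} {k m : ℕ} (hm : m ≠ 0)
    (hT : ∀ t ∈ T, Squarefree t.2.2 ∧ t.2.2 ∣ t.1 ∧ t.2.1.Coprime t.1 ∧
      t.1.primeFactors.card ≤ k) :
    (T.filter (fun t => t.1 * t.2.2 * t.2.1 = m)).card ≤ ((m.primeFactors.card + 1) ^ k) ^ 2 := by
  set Fm := m.primeFactors with hFm
  set Cset := (Fm.powerset.filter (fun S : Finset ℕ => S.card ≤ k)) ×ˢ
    (Fm.powerset.filter (fun S : Finset ℕ => S.card ≤ k)) with hC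
  set φ : ((_ : ℕ) × (ℕ × ℕ)) → Finset ℕ × Finset ℕ :=
    fun t => (t.1.primeFactors, t.2.2.primeFactors) with hφ
  set Tm := T.filter (fun t => t.1 * t.2.2 * t.2.1 = m) with hTm
  -- facts on the fiber
  have hfib : ∀ t ∈ Tm, t.1 ≠ 0 ∧ t.2.2 ≠ 0 ∧ t.2.1 ≠ 0 ∧ Squarefree t.2.2 ∧ t.2.2 ∣ t.1 ∧
      t.2.1.Coprime t.1 ∧ t.1.primeFactors.card ≤ k ∧ t.1 * t.2.2 * t.2.1 = m ∧
      ∀ p : ℕ, (t.1 * t.2.2).factorization p =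
        if p ∈ t.1.primeFactors then m.factorization p else 0 := by
    intro t ht
    obtain ⟨ht', hprod⟩ := Finset.mem_filter.mp ht
    obtain ⟨hsq, heq, hdq, hω⟩ := hT t ht'
    have hq0 : t.1 ≠ 0 := fun h => hm (by rw [← hprod, h]; simp)
    have he0 : t.2.2 ≠ 0 := fun h => hm (by rw [← hprod, h]; simp)
    have hd0 : t.2.1 ≠ 0 := fun h => hm (by rw [← hprod, h]; simp)
    refine ⟨hq0, he0, hd0, hsq, heq, hdq, hω, hprod, fun p => ?_⟩
    have hmf : m.factorization p = (t.1 * t.2.2).factorization p + t.2.1.factorization p := by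
      rw [← hprod, Nat.factorization_mul (Nat.mul_ne_zero hq0 he0) hd0, Finsupp.add_apply]
    by_cases hp : p ∈ t.1.primeFactors
    · rw [if_pos hp, hmf]
      have hpp := Nat.prime_of_mem_primeFactors hp
      have hpq := Nat.dvd_of_mem_primeFactors hp
      have : t.2.1.factorization p = 0 :=
        Nat.factorization_eq_zero_of_not_dvd fun hpd =>
          hpp.one_lt.ne' (Nat.eq_one_of_dvd_coprimes hdq hpd hpq)
      rw [this, add_zero]
    · rw [if_neg hp, Nat.factorization_mul hq0 he0, Finsupp.add_apply]
      by_cases hpp : p.Prime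
      · have hpq : ¬ p ∣ t.1 := fun h => hp (Nat.mem_primeFactors.mpr ⟨hpp, h, hq0⟩)
        rw [Nat.factorization_eq_zero_of_not_dvd hpq,
          Nat.factorization_eq_zero_of_not_dvd (fun h => hpq (h.trans heq)), add_zero]
      · rw [Nat.factorization_eq_zero_of_not_prime _ hpp,
          Nat.factorization_eq_zero_of_not_prime _ hpp, add_zero]
  -- `φ` maps the fiber into `Cset`
  have hmaps : ∀ t ∈ Tm, φ t ∈ Cset := by
    intro t ht
    obtain ⟨hq0, he0, -, -, heq, -, hω, hprod, -⟩ := hfib t ht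
    have hqm : t.1 ∣ m := ⟨t.2.2 * t.2.1, by rw [← hprod]; ring⟩
    have hsub1 : t.1.primeFactors ⊆ Fm := Nat.primeFactors_mono hqm hm
    have hsub2 : t.2.2.primeFactors ⊆ t.1.primeFactors := Nat.primeFactors_mono heq hq0
    simp only [hC, hφ, Finset.mem_product, Finset.mem_filter, Finset.mem_powerset]
    exact ⟨⟨hsub1, hω⟩, hsub2.trans hsub1, (Finset.card_le_card hsub2).trans hω⟩
  -- `φ` is injective on the fiber
  have hinj : Set.InjOn φ ↑Tm := by
    intro t ht t' ht' h
    obtain ⟨hq0, he0, hd0, hsq, heq, hdq, -, hprod, hfac⟩ := hfib t ht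
    obtain ⟨hq0', he0', hd0', hsq', heq', hdq', -, hprod', hfac'⟩ := hfib t' ht'
    simp only [hφ, Prod.mk.injEq] at h
    obtain ⟨hS, hSe⟩ := h
    -- `e = e'`
    have hee : t.2.2 = t'.2.2 := by
      rw [← Nat.prod_primeFactors_of_squarefree hsq, ← Nat.prod_primeFactors_of_squarefree hsq', hSe]
    -- `q e = q' e'`
    have hqe : t.1 * t.2.2 = t'.1 * t'.2.2 := by
      refine Nat.eq_of_factorization_eq (Nat.mul_ne_zero hq0 he0) (Nat.mul_ne_zero hq0' he0')
        fun p => ?_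
      rw [hfac p, hfac' p, hS]
    -- `q = q'`, `d = d'`
    have hqq : t.1 = t'.1 := by
      rw [hee] at hqe
      exact Nat.eq_of_mul_eq_mul_right (Nat.pos_of_ne_zero he0') hqe
    have hdd : t.2.1 = t'.2.1 := by
      have h1 : t.1 * t.2.2 * t.2.1 = t'.1 * t'.2.2 * t'.2.1 := by rw [hprod, hprod']
      rw [hqe] at h1
      exact Nat.eq_of_mul_eq_mul_left (Nat.pos_of_ne_zero (Nat.mul_ne_zero hq0' he0')) h1
    exact Sigma.ext hqq (heq_of_eq (Prod.ext hdd hee))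
  -- count
  calc Tm.card ≤ Cset.card := Finset.card_le_card_of_injOn φ hmaps hinj
    _ = ((Fm.powerset.filter (fun S : Finset ℕ => S.card ≤ k)).card) ^ 2 := by
        rw [hC, Finset.card_product, sq]
    _ ≤ ((m.primeFactors.card + 1) ^ k) ^ 2 :=
        Nat.pow_le_pow_left (card_powerset_filter_card_le Fm k) 2

/-- **Summing over the representations** `m = q e d`: for a finite set of triples as in
`card_fiber_le` with `1 ≤ q e d < X`, and `w ≥ 0`,
`∑_t w(q e d) ≤ ((log₂ X + 1)^k)² ∑_{1 ≤ m < X} w(m)`. [folklore] -/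
theorem sum_triples_le {T : Finset ((_ : ℕ) × (ℕ × ℕ))} {k X : ℕ} (w : ℕ → ℝ) (hw : ∀ m, 0 ≤ w m)
    (hT : ∀ t ∈ T, Squarefree t.2.2 ∧ t.2.2 ∣ t.1 ∧ t.2.1.Coprime t.1 ∧
      t.1.primeFactors.card ≤ k ∧ 1 ≤ t.1 * t.2.2 * t.2.1 ∧ t.1 * t.2.2 * t.2.1 < X) :
    ∑ t ∈ T, w (t.1 * t.2.2 * t.2.1) ≤
      ((((Nat.log 2 X + 1) ^ k) ^ 2 : ℕ) : ℝ) * ∑ m ∈ Finset.Ico 1 X, w m := by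
  set f : ((_ : ℕ) × (ℕ × ℕ)) → ℕ := fun t => t.1 * t.2.2 * t.2.1 with hf
  have hmaps : ∀ t ∈ T, f t ∈ Finset.Ico 1 X := fun t ht =>
    Finset.mem_Ico.mpr ⟨(hT t ht).2.2.2.2.1, (hT t ht).2.2.2.2.2⟩
  rw [← Finset.sum_fiberwise_of_maps_to hmaps, Finset.mul_sum]
  refine Finset.sum_le_sum fun m hm => ?_
  obtain ⟨hm1, hmX⟩ := Finset.mem_Ico.mp hm
  have hm0 : m ≠ 0 := by omega
  have hinner : ∑ t ∈ T.filter (fun t => f t = m), w (f t) =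
      (T.filter (fun t => f t = m)).card * w m := by
    rw [Finset.sum_congr rfl fun t ht => by rw [(Finset.mem_filter.mp ht).2], Finset.sum_const,
      nsmul_eq_mul]
  rw [hinner]
  refine mul_le_mul_of_nonneg_right ?_ (hw m)
  have hcard := card_fiber_le (T := T) (k := k) hm0 fun t ht =>
    ⟨(hT t ht).1, (hT t ht).2.1, (hT t ht).2.2.1, (hT t ht).2.2.2.1⟩
  have hω : m.primeFactors.card ≤ Nat.log 2 X :=
    (card_primeFactors_le_log m).trans (Nat.log_mono_right hmX.le)
  calc ((T.filter (fun t => f t = m)).card : ℝ) ≤ (((m.primeFactors.card + 1) ^ k) ^ 2 : ℕ) := by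
        exact_mod_cast hcard
    _ ≤ (((Nat.log 2 X + 1) ^ k) ^ 2 : ℕ) := by
        exact_mod_cast Nat.pow_le_pow_left (Nat.pow_le_pow_left (by omega) k) 2

end BombieriSieve

end Literature.NumberTheory.Sieve
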